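import Summits.FinalStateConjecture.FinalStateConjecture.Theorems.EIHFluxBalanceInertialRecessionStubEndgameToyInduction

/-!
# Route EIHFluxBalance — crux `InertialRecession`, line `sublinear-is-free-clean-window-charges`:
# the N-body CLEAN-SCALE TOY, `p = 3/2` — every velocity converges (`ToyCleanScaleFrozenMotion N n (3/2)`)

Helper file for the crux `stmt-FinalStateConjecture-10166`
(`Summit.FinalStateConjecture.FinalStateConjecture.Theses.EIHFluxBalance.InertialRecession`), registered stub
`stub_pairwiseDichotomy` (lead reshape r7) of `Cruxes/InertialRecession/Lines/sublinear_is_free_clean_window_charges.lean`;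
fourth file of the toy series (`…ToyBasics`, `…ToyCross`, `…ToyInduction`).

`toy_frozen_three_halves` is, verbatim, the disprover's open target `ToyCleanScaleFrozenMotion N n (3/2)`
(`Cruxes/InertialRecession/Disproof.lean` §I, one `sorry` there) with the definition unfolded: `N` world-lines in `ℝⁿ`,
`ξ̇ = v`, `v̇ = a`, pairwise separating, clean-cluster balance `‖Σ_{i∈C} mᵢaᵢ(t)‖ ≤ K r^{-3/2}` for clusters isolated by
`r ≤ t` ⟹ every `vᵢ(t)` converges. (The bounded-speed hypothesis of the toy is not used.) Proof: uniform Cauchy control —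
for every `η > 0` there is a late time `T′` after which no velocity moves by more than `η`: choose worst-case lateness scales
`A₀, T₁` from `η` (ballistic quantum and time term below the smallest threshold that can occur), a time `T′` after which all
distances exceed `A₀`, split all bodies by the EMPTY BAND of the velocity configuration at `T′` (threshold `θ′ ≤ η/400`), and run
`crossBootstrap` with the slow-group lemma `slowGroup_induction` at level `N`: drifts `≤ 12θ′ + 12Nθ_g ≤ 13θ′ ≤ η`. Then the
Cauchy criterion in the complete space `ℝⁿ`.

References: D. Saari, Trans. AMS 156 (1971) 219–240; C. Marchal, D. Saari, J. Differential Equations 20 (1976) 150–186;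
J. Dereziński, C. Gérard, Scattering theory of classical and quantum N-particle systems (Springer 1997), Ch. 5.
-/

noncomputable section

set_option linter.dupNamespace false

open Filter Topology Set MeasureTheory intervalIntegral
open scoped Topology BigOperators

namespace Summit.FinalStateConjecture.FinalStateConjecture.Theorems.SublinearIsFree.Toy

open Literature.Geometry.Lorentzian
open Summit.FinalStateConjecture.FinalStateConjecture.Theorems.SublinearIsFree.Endgame

/-- Uniform Cauchy control at `atTop` gives a limit in a complete space. [folklore] -/
theorem exists_tendsto_of_uniform_cauchy {E : Type*} [NormedAddCommGroup E] [CompleteSpace E] (f : ℝ → E)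
    (h : ∀ η : ℝ, 0 < η → ∃ T : ℝ, ∀ t, T ≤ t → ‖f t - f T‖ ≤ η) : ∃ W : E, Tendsto f atTop (𝓝 W) := by
  have hc : Cauchy (map f atTop) := by
    rw [Metric.cauchy_iff]
    refine ⟨map_neBot, fun ε hε ↦ ?_⟩
    obtain ⟨T, hT⟩ := h (ε / 3) (by positivity)
    refine ⟨f '' Ici T, image_mem_map (Ici_mem_atTop T), ?_⟩
    rintro x ⟨t, ht, rfl⟩ y ⟨s, hs, rfl⟩
    calc dist (f t) (f s) = ‖(f t - f T) - (f s - f T)‖ := by rw [dist_eq_norm]; abel_nf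
      _ ≤ ‖f t - f T‖ + ‖f s - f T‖ := norm_sub_le _ _
      _ ≤ ε / 3 + ε / 3 := add_le_add (hT t ht) (hT s hs)
      _ < ε := by linarith
  exact cauchy_map_iff_exists_tendsto.mp hc

set_option maxHeartbeats 800000 in
/-- **THE CLEAN-SCALE N-BODY TOY FREEZES VELOCITIES (`p = 3/2`, every `N`).** The statement is the disprover's
`ToyCleanScaleFrozenMotion N n (3/2)` unfolded; see the module docstring for the proof. [folklore] -/
theorem toy_frozen_three_halves {N n : ℕ} :
    ∀ (m : Fin N → ℝ) (ξ v a : Fin N → ℝ → (Fin n → ℝ)) (t₀ K vmax : ℝ), 0 < t₀ → 0 ≤ K →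
    (∀ i, 0 < m i) → (∀ i t, HasDerivAt (ξ i) (v i t) t) → (∀ i t, HasDerivAt (v i) (a i t) t) →
    (∀ i t, t₀ ≤ t → ‖v i t‖ ≤ vmax) →
    (∀ i j, i ≠ j → Tendsto (fun t ↦ ‖ξ i t - ξ j t‖) atTop atTop) →
    (∀ (C : Finset (Fin N)) (t r : ℝ), t₀ ≤ t → 0 < r → r ≤ t → C.Nonempty →
      (∀ i ∈ C, ∀ j ∉ C, r ≤ ‖ξ i t - ξ j t‖) → ‖∑ i ∈ C, m i • a i t‖ ≤ K * r ^ (-(3 / 2 : ℝ))) →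
    ∀ i, ∃ W : Fin n → ℝ, Tendsto (v i) atTop (𝓝 W) := by
  intro m ξ v a t₀ K vmax ht₀ hK hm hξ hv _ hsep hbal i
  classical
  -- degenerate space `n = 0`
  by_cases hn : Nonempty (Fin n)
  swap
  · haveI : IsEmpty (Fin n) := not_nonempty_iff.mp hn
    refine ⟨v i 0, ?_⟩
    have : v i = fun _ ↦ v i 0 := funext fun t ↦ Subsingleton.elim _ _
    rw [this]; exact tendsto_const_nhds
  haveI := hn
  -- sizes and the minimal mass
  have hNpos : 0 < N := Fin.pos i
  have hN1 : (1 : ℝ) ≤ N := by exact_mod_cast hNpos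
  have hN0 : (0 : ℝ) < N := by linarith
  obtain ⟨mmin, hmmin, hmle⟩ : ∃ mmin : ℝ, 0 < mmin ∧ ∀ j, mmin ≤ m j := by
    obtain ⟨j₀, -, hj₀⟩ := Finset.exists_min_image Finset.univ m ⟨i, Finset.mem_univ _⟩
    exact ⟨m j₀, hm j₀, fun j ↦ hj₀ j (Finset.mem_univ _)⟩
  refine exists_tendsto_of_uniform_cauchy (v i) fun η hη ↦ ?_
  -- opaque base power
  set P : ℝ := (400 : ℝ) ^ (N ^ 3 + N) with hP
  have hP1 : 1 ≤ P := one_le_pow₀ (by norm_num)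
  have hPpos : 0 < P := by positivity
  -- worst-case constants from `η`
  set c₁ : ℝ := (400 : ℝ) ^ (N * N + 1) with hc₁
  have hc₁pos : 0 < c₁ := by positivity
  set c₂ : ℝ := 48 * N * P with hc₂
  have hc₂pos : 0 < c₂ := by positivity
  set θgm : ℝ := η / c₁ / c₂ with hθgm
  have hθgmpos : 0 < θgm := by positivity
  set εm : ℝ := θgm / (100 * N ^ 3) with hεm
  have hεmpos : 0 < εm := by positivity
  set X : ℝ := K * (2 * √2 * 8) with hX
  have hX0 : 0 ≤ X := by positivity
  set A₀ : ℝ := (X / (θgm * (mmin * εm)) + 1) ^ 2 with hA₀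
  have hA₀pos : 0 < A₀ := by positivity
  have hsqrtA₀ : √A₀ = X / (θgm * (mmin * εm)) + 1 := Real.sqrt_sq (by positivity)
  set T₁ : ℝ := (K * 2 / (mmin * εm) + 1) ^ 2 with hT₁
  have hsqrtT₁ : √T₁ = K * 2 / (mmin * εm) + 1 := Real.sqrt_sq (by positivity)
  have hT₁1 : 1 ≤ T₁ := by
    have h0 : 0 ≤ K * 2 / (mmin * εm) := by positivity
    rw [hT₁]; nlinarith
  -- a late time after which all distances are `≥ A₀`
  obtain ⟨T', hT't₀, hT'T₁, hfar⟩ : ∃ T' : ℝ, t₀ ≤ T' ∧ T₁ ≤ T' ∧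
      ∀ k l : Fin N, k ≠ l → ∀ t, T' ≤ t → A₀ ≤ ‖ξ k t - ξ l t‖ := by
    have hev : ∀ᶠ t in atTop, ∀ p : Fin N × Fin N, p.1 ≠ p.2 → A₀ ≤ ‖ξ p.1 t - ξ p.2 t‖ := by
      rw [Filter.eventually_all]
      intro p
      by_cases hp : p.1 = p.2
      · exact Eventually.of_forall fun t h ↦ absurd hp h
      · exact ((hsep p.1 p.2 hp).eventually_ge_atTop A₀).mono fun t ht _ ↦ ht
    obtain ⟨T₂, hT₂⟩ := eventually_atTop.mp hev
    refine ⟨max (max t₀ T₁) T₂, (le_max_left _ _).trans (le_max_left _ _),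
      (le_max_right _ _).trans (le_max_left _ _), fun k l hkl t ht ↦ ?_⟩
    exact hT₂ t ((le_max_right _ _).trans ht) (k, l) hkl
  have hT'1 : 1 ≤ T' := hT₁1.trans hT'T₁
  have hT'pos : 0 < T' := one_pos.trans_le hT'1
  -- the empty band at `T'` over all bodies
  obtain ⟨θ', hθ'lo, hθ'hi, hθ'pos, hdich, htrans⟩ :=
    exists_gap_finset (Finset.univ : Finset (Fin N)) (fun j ↦ v j T') hη (by norm_num : (2 : ℝ) ≤ 400)
  have hcardU : (Finset.univ : Finset (Fin N)).card = N := by simp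
  rw [hcardU] at hθ'lo
  -- `θg`, `ε₀` and their worst-case lower bounds
  set θg : ℝ := θ' / c₂ with hθg
  have hθgpos : 0 < θg := by positivity
  have hθg_ge : θgm ≤ θg := by
    rw [hθgm, hθg]
    exact div_le_div_of_nonneg_right hθ'lo hc₂pos.le
  set ε₀ : ℝ := θg / (100 * N ^ 3) with hε₀
  have hε₀pos : 0 < ε₀ := by positivity
  have hε₀_ge : εm ≤ ε₀ := by
    rw [hεm, hε₀]
    exact div_le_div_of_nonneg_right hθg_ge (by positivity)
  have hεθ : 100 * (N : ℝ) ^ 3 * ε₀ ≤ θg := by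
    rw [hε₀]
    have : (100 : ℝ) * N ^ 3 ≠ 0 := by positivity
    rw [mul_div_cancel₀ _ this]
  -- the two lateness inequalities
  have hE1 : K * (2 * √2 * (8 / (θg * √A₀))) ≤ mmin * ε₀ := by
    have hsA : 0 < √A₀ := Real.sqrt_pos.mpr hA₀pos
    have hrew : K * (2 * √2 * (8 / (θg * √A₀))) = X / (θg * √A₀) := by
      rw [hX]; field_simp
    rw [hrew, div_le_iff₀ (mul_pos hθgpos hsA)]
    -- `X ≤ θgm · mmin εm · √A₀ ≤ θg · mmin ε₀ · √A₀`
    have h1 : X ≤ θgm * (mmin * εm) * √A₀ := by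
      rw [hsqrtA₀, mul_add, mul_one, mul_div_cancel₀ _ (by positivity)]
      have : 0 ≤ θgm * (mmin * εm) := by positivity
      linarith
    have h2 : θgm * (mmin * εm) * √A₀ ≤ θg * (mmin * ε₀) * √A₀ := by
      have := mul_le_mul hθg_ge (mul_le_mul_of_nonneg_left hε₀_ge hmmin.le) (by positivity) hθgpos.le
      exact mul_le_mul_of_nonneg_right this hsA.le
    linarith
  have hE2 : K * (2 * (√T')⁻¹) ≤ mmin * ε₀ := by
    have hsT₁ : 0 < √T₁ := Real.sqrt_pos.mpr (one_pos.trans_le hT₁1)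
    have hsT' : √T₁ ≤ √T' := Real.sqrt_le_sqrt hT'T₁
    have h1 : K * (2 * (√T')⁻¹) ≤ K * (2 * (√T₁)⁻¹) := by
      gcongr
    have h2 : K * (2 * (√T₁)⁻¹) ≤ mmin * εm := by
      rw [show K * (2 * (√T₁)⁻¹) = K * 2 / √T₁ by ring, div_le_iff₀ hsT₁, hsqrtT₁, mul_add, mul_one,
        mul_div_cancel₀ _ (by positivity)]
      have : 0 ≤ mmin * εm := by positivity
      linarith
    have h3 : mmin * εm ≤ mmin * ε₀ := mul_le_mul_of_nonneg_left hε₀_ge hmmin.le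
    linarith
  -- the level-`N` threshold is exactly `θ'`
  have hthr : 24 * (N + N) * θg * 400 ^ (N ^ 3 + N) ≤ θ' := by
    have : 24 * ((N : ℝ) + N) * θg * P = θ' := by
      rw [hθg, hc₂]; field_simp; ring
    rw [← hP]; exact this.le
  -- the slow-group lemma at level `N` and the cross bootstrap over all bodies
  have hΛ := slowGroup_induction hmle hmmin hK hξ hv hbal hT't₀ hT'1 hA₀pos hfar hθgpos hε₀pos.le hεθ hE1 hE2 N
  have hbud : ∀ u, K * (∫ _ in T'..u, (0 : ℝ)) + mmin * (N ^ 2 * ε₀) ≤ mmin * (10 * θg + (N - N) * (N ^ 2 * ε₀)) := by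
    intro u
    rw [intervalIntegral.integral_zero, mul_zero, zero_add, sub_self, zero_mul, add_zero]
    refine mul_le_mul_of_nonneg_left ?_ hmmin.le
    -- `N²ε₀ = θg/(100N) ≤ 10θg`
    have h1 : (N : ℝ) ^ 2 * ε₀ * (100 * N) = θg := by
      rw [hε₀]; field_simp
    nlinarith
  refine ⟨T', fun t ht ↦ ?_⟩
  have hdrift := crossBootstrap (T := T') hK hξ hv hA₀pos hfar hθgpos hε₀pos.le hmmin hE1 hΛ le_rfl ht hθ'pos
    (fun k _ l _ ↦ hdich k (Finset.mem_univ _) l (Finset.mem_univ _))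
    (fun k _ l _ j _ ↦ htrans k (Finset.mem_univ _) l (Finset.mem_univ _) j (Finset.mem_univ _)) hthr
    (fun k _ ↦ (Finset.card_le_univ _).trans hcardU.le) continuous_const (fun _ ↦ le_rfl)
    (fun s _ i _ j hj ↦ absurd (Finset.mem_univ j) hj) (hbud t) i (Finset.mem_univ i) t ⟨ht, le_rfl⟩
  -- `12θ' + 12Nθg ≤ η`
  have h1 : 12 * (N : ℝ) * θg ≤ θ' / 4 := by
    have : 12 * (N : ℝ) * θg * (4 * P) = θ' := by
      rw [hθg, hc₂]; field_simp; ring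
    nlinarith
  have h2 : θ' ≤ η / 400 := hθ'hi
  linarith

/-- Registered helper form: the clean-scale N-body toy with `p = 3/2` freezes every velocity. [folklore] -/
theorem endgame_toy_frozen_three_halves : open Filter Topology in ∀ (N n : ℕ) (m : Fin N → ℝ) (ξ v a : Fin N → ℝ → (Fin n → ℝ)) (t₀ K vmax : ℝ), 0 < t₀ → 0 ≤ K → (∀ i, 0 < m i) → (∀ i t, HasDerivAt (ξ i) (v i t) t) → (∀ i t, HasDerivAt (v i) (a i t) t) → (∀ i t, t₀ ≤ t → ‖v i t‖ ≤ vmax) → (∀ i j, i ≠ j → Tendsto (fun t ↦ ‖ξ i t - ξ j t‖) atTop atTop) → (∀ (C : Finset (Fin N)) (t r : ℝ), t₀ ≤ t → 0 < r → r ≤ t → C.Nonempty → (∀ i ∈ C, ∀ j ∉ C, r ≤ ‖ξ i t - ξ j t‖) → ‖∑ i ∈ C, m i • a i t‖ ≤ K * r ^ (-(3 / 2 : ℝ))) → ∀ i, ∃ W : Fin n → ℝ, Tendsto (v i) atTop (𝓝 W) :=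
  fun _ _ ↦ toy_frozen_three_halves

end Summit.FinalStateConjecture.FinalStateConjecture.Theorems.SublinearIsFree.Toy

end
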